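import Summits.BirchSwinnertonDyer.BirchSwinnertonDyer.Theorems.ErratumRoadFiveNonSurjCornerTwinTateParameterPow
import Summits.BirchSwinnertonDyer.Rank1Residual.Partition.Rows
import Literature.NumberTheory.EllipticCurves.PAdicHeightsProofs
import HarnessLib

/-!
# Crux `UpperNonSurjFive` (item stmt-BirchSwinnertonDyer-20614), negative side: the instrument «w = 1»
# («the Tate period is non-Wieferich», `ord_p log_p q_E = 1`) is UNSATISFIABLE on the non-surjective
# multiplicative locus — every Tate datum there has `ord_p log_p q_E ≥ 2`

Negative-lane support file for the crux
`Summit.BirchSwinnertonDyer.BirchSwinnertonDyer.Theses.PrintX11a.UpperNonSurjFive` (route PrintX11a), written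
by the cell referee of `bsd-print-x11a` (REF g24, LINE NOTE «gsdepth5», HOME `REF-AUDIT.md` §X.2). It refutes
NO Theses statement and closes nothing: the crux stays OPEN. What it puts in the kernel is the vacuity, on
the crux's own locus, of the per-pair instrument of the published line
`Cruxes/UpperNonSurjFive/Lines/gsdepth5.lean` (ideator bsd-idea-6 g12):

  `GSDepth.LogTatePeriodUnit W p := ∀ D : TateParameterData W p, (padicLog p D.q).valuation = 1`

(«w = 1», Skinner–Zhang 2014 hypothesis (b) in the tree's currency). Both closed sectors of that line,
`ExcGSSectorA` and `ExcGSSectorB`, carry the antecedents `ClassX11a W p`, `¬ Surj W p`, `p` split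
multiplicative AND `LogTatePeriodUnit W p`; this file proves those four are jointly contradictory, so the
two sectors cover no pair at any prime, and the line's residual `ExcResidualGS` (whose disjunct
`¬ LogTatePeriodUnit W p` then holds at every split pair of the locus) coincides with the rev-11 open core
`C_exc♭` it was meant to cut.

## The argument (Serre 1972 §2.4 Prop. 15 + Tate's uniformisation; all steps already in the tree)

On `Mult W p ∧ Irr W p ∧ ¬ Surj W p` (`p` odd) the image of `ρ̄_{E,p}` has order prime to `p`
(an irreducible subgroup of `GL₂(𝔽_p)` of order divisible by `p` with surjective determinant is all of
`GL₂(𝔽_p)`, Serre Prop. 15), so the decomposition group at `p` contains no transvection and the Kummer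
class of the Tate parameter vanishes: `q_E ∈ (ℚ_p^×)^p`. In the kernel this is
`Theorems.TatePow.TateParameterData.exists_pow_eq_q_of_irr_of_not_surj` (cell `bsd-stepL`, transported to
`ℚ_[p]` along Mathlib's `adicCompletion.padicEquiv`; the `ℚ_v` form is ty2's
`ClassX11a.exists_pow_eq_tateParameter_of_not_surj`, REF ruling R4-1). Writing `q_E = r^p`,
`log_p q_E = p · log_p r` with `‖log_p r‖ ≤ p⁻¹` (Iwasawa logarithm), so `‖log_p q_E‖ ≤ p⁻²`
(`X11b.MuAnUnit.norm_padicLog_pow_prime_le`): `ord_p log_p q_E ≥ 2` whenever `log_p q_E ≠ 0`, and the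
valuation is `0` by convention when `log_p q_E = 0` — in neither case `1`. Equivalently: the unit part
`u = q_E p^{−ord_p q_E}` is a `p`-th power in `ℤ_p^×`, i.e. `u^{p−1} ≡ 1 (mod p²)`. (Engine check, kit
job j327971: at `p = 5` all 23 split non-surjective X11a census pairs have `ord₅ log₅ q_E ∈ {2, 3}` and
`u mod 25 ∈ μ₄(ℤ/25ℤ)`.)

## Contents (theorems only; no definition, no named fact, no `sorry`, nothing booked)
* `two_le_valuation_padicLog_pow`, `valuation_padicLog_pow_ne_one` — `log_p` of a `p`-th power (`p` odd);
* `valuation_padicLog_q_ne_one_of_irr_of_not_surj`, `two_le_valuation_padicLog_q_of_irr_of_not_surj` —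
  on `Mult ∧ Irr ∧ ¬Surj` every Tate datum has `w ≠ 1` (`w ≥ 2` when the logarithm is nonzero);
* `valuation_padicLog_q_ne_one_of_classX11a_of_not_surj` — the same on `ClassX11a ∧ ¬Surj`;
* `not_logTatePeriodUnit_of_classX11a_of_not_surj` — at a SPLIT `p` (a Tate datum exists,
  `nonempty_tateParameterData_iff_holds`) the instrument «w = 1», restated verbatim, FAILS;
* `not_exists_gsSector_antecedents` — the common antecedent bundle of `ExcGSSectorA`/`ExcGSSectorB`
  (`ClassX11a`, `¬Surj`, split `p`, «w = 1») is uninhabited.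

HONEST FRAMING: boundary ∕ negative-lane theorems; NOT a class theorem; PARTITION currency 0; beyond-print
theorem: no — classical (Serre 1972 Prop. 15, Silverman ATAEC V.5.3/V.6.1, the Iwasawa logarithm), new only
as a tree theorem about a tree instrument.

References: [Serre1972] §2.4 Prop. 15 (p. 280), §1.11–1.12; [SilvermanATAEC1994] Thm. V.5.3, Prop. V.6.1,
Ex. 5.13; [Iwasawa1972PadicL] §4.4; [SkinnerZhang2014] Thm. 1.1 (b); [MazurTateTeitelbaum1986Invent] §II.1;
tree: `Theorems/ErratumRoadFiveNonSurjCornerTwinTateParameterPow.lean`,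
`Theorems/ErratumRoadFiveNonSurjCornerTwinMuAnSplitLinearCoefficient.lean`, `X11a/PrintDischargeLocallySplit.lean`,
`Literature/…/PAdicHeightsProofs.lean`; cell: HOME `REF-AUDIT.md` §F (R4-1), §X.2; kit job j327971.
-/

set_option autoImplicit false
set_option linter.dupNamespace false

noncomputable section

open scoped Classical
open WeierstrassCurve Literature.NumberTheory.EllipticCurves Literature.NumberTheory.EllipticCurves.Rank1Residual
  Summit.BirchSwinnertonDyer.Rank1Residual

namespace Summit.BirchSwinnertonDyer.BirchSwinnertonDyer.Theorems.UpperNonSurjFive.Negative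

variable {W : WeierstrassCurve ℚ} [W.IsElliptic] {p : ℕ} [Fact p.Prime]

/-! ### §1 The Iwasawa logarithm of a `p`-th power has valuation `≥ 2` -/

omit [W.IsElliptic] in
/-- **`ord_p log_p (r^p) ≥ 2`** for `p` odd, `r ≠ 0`, `log_p (r^p) ≠ 0`: `‖log_p (r^p)‖ ≤ p⁻²`
(`norm_padicLog_pow_prime_le`: `log_p (r^p) = p·log_p r`, `‖log_p r‖ ≤ p⁻¹`) and `‖x‖ = p^{−ord_p x}`.
[cite: Iwasawa1972PadicL, §4.4] -/
theorem two_le_valuation_padicLog_pow (hp2 : p ≠ 2) {r : ℚ_[p]} (hr : r ≠ 0)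
    (h0 : padicLog p (r ^ p) ≠ 0) : 2 ≤ (padicLog p (r ^ p)).valuation := by
  have hp : p.Prime := Fact.out
  have h1p : (1 : ℝ) < p := by exact_mod_cast hp.one_lt
  have hle := Summit.BirchSwinnertonDyer.Rank1Residual.X11b.MuAnUnit.norm_padicLog_pow_prime_le hp2 hr
  rw [Padic.norm_eq_zpow_neg_valuation h0] at hle
  have h2 : (p : ℝ)⁻¹ * (p : ℝ)⁻¹ = (p : ℝ) ^ (-(2 : ℤ)) := by
    rw [zpow_neg, zpow_two, mul_inv]
  rw [h2, zpow_le_zpow_iff_right₀ h1p] at hle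
  omega

omit [W.IsElliptic] in
/-- **`ord_p log_p (r^p) ≠ 1`** for `p` odd, `r ≠ 0` (valuation `≥ 2`, or the logarithm vanishes and
Mathlib's `Padic.valuation 0 = 0`). [cite: Iwasawa1972PadicL, §4.4] -/
theorem valuation_padicLog_pow_ne_one (hp2 : p ≠ 2) {r : ℚ_[p]} (hr : r ≠ 0) :
    (padicLog p (r ^ p)).valuation ≠ 1 := by
  by_cases h0 : padicLog p (r ^ p) = 0
  · rw [h0, Padic.valuation_zero]; norm_num
  · have h2 := two_le_valuation_padicLog_pow hp2 hr h0
    omega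

/-! ### §2 On the non-surjective multiplicative locus every Tate datum has `w ≠ 1` -/

/-- **`Mult ∧ Irr ∧ ¬Surj` (`p` odd) ⟹ `ord_p log_p q ≠ 1` for every Tate parameter datum**: the datum
is a `p`-th power in `ℚ_p` (`TatePow.TateParameterData.exists_pow_eq_q_of_irr_of_not_surj`: no
transvection in the image, Serre Prop. 15, so the Kummer class of `q` vanishes), and §1.
[cite: Serre1972, §2.4 Prop. 15 (p. 280)] [cite: SilvermanATAEC1994, Thm. V.5.3, Prop. V.6.1, Ex. 5.13] -/
theorem valuation_padicLog_q_ne_one_of_irr_of_not_surj (hp2 : p ≠ 2) (hmult : Mult W p)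
    (hirr : Irr W p) (hns : ¬ Surj W p) (D : TateParameterData W p) :
    (padicLog p D.q).valuation ≠ 1 := by
  obtain ⟨r, hr⟩ :=
    Summit.BirchSwinnertonDyer.BirchSwinnertonDyer.Theorems.TatePow.TateParameterData.exists_pow_eq_q_of_irr_of_not_surj
      W p hp2 hmult hirr hns D
  have hr0 : r ≠ 0 := by
    rintro rfl
    apply D.q_ne_zero
    rw [← hr, zero_pow (Fact.out : p.Prime).ne_zero]
  rw [← hr]
  exact valuation_padicLog_pow_ne_one hp2 hr0

/-- **`Mult ∧ Irr ∧ ¬Surj` (`p` odd) ⟹ `ord_p log_p q ≥ 2`** for every Tate datum with `log_p q ≠ 0`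
(the unit part of `q` is a `p`-th power in `ℤ_p^×`, `u^{p−1} ≡ 1 (mod p²)`).
[cite: Serre1972, §2.4 Prop. 15 (p. 280)] [cite: Iwasawa1972PadicL, §4.4] -/
theorem two_le_valuation_padicLog_q_of_irr_of_not_surj (hp2 : p ≠ 2) (hmult : Mult W p)
    (hirr : Irr W p) (hns : ¬ Surj W p) (D : TateParameterData W p) (h0 : padicLog p D.q ≠ 0) :
    2 ≤ (padicLog p D.q).valuation := by
  obtain ⟨r, hr⟩ :=
    Summit.BirchSwinnertonDyer.BirchSwinnertonDyer.Theorems.TatePow.TateParameterData.exists_pow_eq_q_of_irr_of_not_surj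
      W p hp2 hmult hirr hns D
  have hr0 : r ≠ 0 := by
    rintro rfl
    apply D.q_ne_zero
    rw [← hr, zero_pow (Fact.out : p.Prime).ne_zero]
  rw [← hr] at h0 ⊢
  exact two_le_valuation_padicLog_pow hp2 hr0 h0

/-- **`ClassX11a ∧ ¬Surj` ⟹ `ord_p log_p q ≠ 1` for every Tate datum** (the class supplies `p ≠ 2`,
`Mult`, `Irr`). [cite: Serre1972, §2.4 Prop. 15 (p. 280)] [cite: SilvermanATAEC1994, Thm. V.5.3, Prop. V.6.1] -/
theorem valuation_padicLog_q_ne_one_of_classX11a_of_not_surj [W.IsGloballyMinimal]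
    (hX : ClassX11a W p) (hns : ¬ Surj W p) (D : TateParameterData W p) :
    (padicLog p D.q).valuation ≠ 1 :=
  valuation_padicLog_q_ne_one_of_irr_of_not_surj hX.2.1 hX.2.2.1 hX.2.2.2.1 hns D

/-! ### §3 The instrument «w = 1» fails at every split prime of the locus -/

/-- **«w = 1» is FALSE on `ClassX11a ∧ ¬Surj` at a SPLIT `p`**: a Tate datum exists
(`nonempty_tateParameterData_iff_holds`, ATAEC V.5.3) and has `ord_p log_p q ≠ 1` (§2). The negated
statement is `GSDepth.LogTatePeriodUnit W p` of `Cruxes/UpperNonSurjFive/Lines/gsdepth5.lean`, restated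
verbatim. [cite: SilvermanATAEC1994, Thm. V.5.3] [cite: SkinnerZhang2014, Thm. 1.1 (b)] -/
theorem not_logTatePeriodUnit_of_classX11a_of_not_surj [W.IsGloballyMinimal]
    (hX : ClassX11a W p) (hns : ¬ Surj W p) (hsplit : W.HasSplitMultiplicativeReductionAtPrime p) :
    ¬ ∀ D : TateParameterData W p, (padicLog p D.q).valuation = 1 := by
  intro hw
  obtain ⟨D⟩ := (nonempty_tateParameterData_iff_holds W p).2 hsplit
  exact valuation_padicLog_q_ne_one_of_classX11a_of_not_surj hX hns D (hw D)

/-- **The common antecedent bundle of gsdepth5's sectors `ExcGSSectorA` ∕ `ExcGSSectorB` is uninhabited**: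
no `E/ℚ` (globally minimal) and prime `p` satisfy `ClassX11a W p`, `¬ Surj W p`, split multiplicative
reduction at `p` and «w = 1» together — both sectors are closed because EMPTY.
[cite: Serre1972, §2.4 Prop. 15 (p. 280)] [cite: SilvermanATAEC1994, Thm. V.5.3] -/
theorem not_exists_gsSector_antecedents :
    ¬ ∃ (W : WeierstrassCurve ℚ) (_ : W.IsElliptic) (_ : W.IsGloballyMinimal) (p : ℕ) (_ : Fact p.Prime),
      ClassX11a W p ∧ ¬ Surj W p ∧ W.HasSplitMultiplicativeReductionAtPrime p ∧
        ∀ D : TateParameterData W p, (padicLog p D.q).valuation = 1 := by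
  rintro ⟨W, _, _, p, _, hX, hns, hsplit, hw⟩
  exact not_logTatePeriodUnit_of_classX11a_of_not_surj hX hns hsplit hw

end Summit.BirchSwinnertonDyer.BirchSwinnertonDyer.Theorems.UpperNonSurjFive.Negative

end
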